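import Literature.Probability.Percolation.TriApproxDomainAssembly
import Literature.Probability.Percolation.CardyFormulaConformalInvariance
import HarnessLib

/-!
# (D′) Smirnov's discrete separating data exist: the discharge

Topic `Literature/Probability/Percolation`; family `crit-perc`. Sibling proof file of
`SmirnovSeparatingData.lean`, discharging its named fact **(D′)**
`Literature.Probability.Percolation.smirnov_exists_separatingData` (Bollobás–Riordan,
*Percolation* (2006), Ch. 7, §7.2.2–7.2.6): for a conformal rectangle with a Carleson datum there
are two systems of discrete separating data (`IsSeparatingData`: (9) p. 180, (31)/(34)
pp. 196–197, Lemma 13 p. 181, the estimates of the proofs of Claims 22–23 pp. 198–201)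
sandwiching G02's crossing probability `triDomainCrossingProb` ((40) p. 201 with (19) of Lemma 14,
p. 184, and the robustness remark p. 195).

The proof is the assembly already in the tree:

* `tri_exists_discreteApprox_proof` (`TriApproxDomainAssembly.lean`) — **Lemma 14 with (19)**
  (p. 184; Claims 17–21 pp. 185–195; "considering a sequence `ε₁ → 0`", p. 195): the discrete
  approximations `G_δ∓` of an anticlockwise conformal rectangle (`IsDiscreteApprox`) with the
  sandwich (19) for `triDomainCrossingProb`;
* `smirnov_exists_separatingData_of_exists_discreteApprox`
  (`CardyFormulaConformalInvariance.lean`) — (D′) from Lemma 14, through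
  `smirnov_exists_separatingData_of_facts` (`TriLemma12.lean`/`TriApproxDomain.lean`: the
  separating probabilities (9) of `G_δ∓` as the data; Lemma 13 `tri_discreteCauchy_holds`,
  (40) `tri_openCrossingProb_approx_sepProb_holds`, Claim 23
  `tri_sepProb_boundary_tendsto_holds`, Claim 10 `tri_sepEvent_diff_subset_arms_holds`,
  Lemma 12 `tri_sepDiffProb_rotate_holds`, Lemma 4 `tri_annulusCrossing_bound_holds`; the
  clockwise marking reduced to the anticlockwise one by complex conjugation, which preserves
  `𝕋` and `P_{1/2}`).

No new definitions, no new named facts.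

## References

* B. Bollobás, O. Riordan, *Percolation*, Cambridge University Press (2006), Ch. 7 §7.2:
  (9) p. 180, Lemma 13 p. 181, Lemma 14 p. 184 with (19), Claims 17–21 pp. 185–195, Claim 20
  p. 192, remark p. 195, §7.2.6 pp. 195–203 ((31)–(34), Claims 22–23, (40), proof of Thm. 2).
* S. Smirnov, *Critical percolation in the plane: conformal invariance, Cardy's formula, scaling
  limits*, C. R. Acad. Sci. Paris Sér. I 333 (2001) 239–244, Thm. 1.
-/

namespace Literature.Probability.Percolation

/-- **(D′) Existence of Smirnov's discrete separating data, PROVED** (Bollobás–Riordan 2006,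
Ch. 7, §7.2.2–7.2.6): for every conformal rectangle `R = (Ω; a', b', c', d')` with a Carleson
datum `(a, b, c, d, ψ)` there are discrete separating data `(S⁻, f⁻)`, `(S⁺, f⁺)` for `R` with
the root of unity `triangleTurn a b c`, points `z_δ∓ ∈ S_δ∓ ∩ Ω` tending to `d'` and `e(δ) → 0`
with `f⁻_δ¹(z⁻_δ) - e(δ) ≤ P_{1/2}[C_δ(Ω; a'b' ↔ c'd')] ≤ f⁺_δ¹(z⁺_δ) + e(δ)` eventually as
`δ → 0⁺`. Obtained from Lemma 14 with (19) (`tri_exists_discreteApprox_proof`) by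
`smirnov_exists_separatingData_of_exists_discreteApprox`. [cite: BollobasRiordan2006, Ch. 7 (9) p. 180, Lemma 13 p. 181, Lemma 14 p. 184, (19), Claim 20 p. 192, p. 195, (31)–(34) pp. 196–197, Claims 22–23 pp. 197–201, (40) p. 201, p. 203] -/
theorem smirnov_exists_separatingData_holds : smirnov_exists_separatingData :=
  smirnov_exists_separatingData_of_exists_discreteApprox tri_exists_discreteApprox_proof

end Literature.Probability.Percolation
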